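import Literature.Barriers.Parity.SiegelZeroGoldbachNonUnit
import Literature.Barriers.Parity.SiegelZeroGoldbachSingular
import HarnessLib

/-!
# Goldston–Suriajaya, Theorem 1: the numerical estimates at `ρ = 1 − 1/N` (§5), proved

Sibling of `Literature/Barriers/Parity/SiegelZeroPrimePairs.lean` (Goldston–Suriajaya,
arXiv:2104.09407, Theorem 1 = the named fact `Literature.Barriers.Parity.GoldstonSuriajaya2021_goldbach`).
Everything in this file is PROVED. It instantiates the abstract estimates of
`SiegelZeroGoldbachPrimeSide.lean`, `SiegelZeroGoldbachNonUnit.lean` and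
`SiegelZeroGoldbachSingular.lean` at the weight `ρ = 1 − 1/N` (the source uses `r = e^{−1/N}`;
with `ρ = 1 − 1/N` one has exactly `1 − ρ = 1/N` and `M = (N − 1)/φ`), and isolates the
bookkeeping of GS21 §5 (proof of Theorem 3) in the two parities:

* `one_sub_div_le_pow_rho`, `pow_rho_mul_le_one`, `pow_rho_mul_le_exp_neg` — `1 − k/N ≤ ρ^k`,
  `ρ^k(1 + k/N) ≤ 1`, `ρ^{NL} ≤ e^{−L}`;
* `excS_ge_inst` — `S ≥ (1 − δ/32)M` once `(1 − β)log(NL) ≤ δ/64` and `e^{−L}(1 + 2L) ≤ δ/64`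
  (GS21: `Γ(β₁)²N^{2(β₁−1)} = 1 + o(1)` unless `β₁ < 1 − C(δ)/log²q`);
* `approx_all`, `errE_le` — the hypothesis of `psiGen_sub_main_le` from (PNTAP) for `n ≥ 2`, and
  `E ≤ (δ/100)M` for `N` large (GS21: the error `O(φ(q)e^{−c₁√log N}) = o(1)`);
* `mul_singW_le_inst`, `mul_singW_ge_inst` — `q W ≤ (1 + δ/16)(N − 1)²/φ(q)` and
  `q W ≥ (1 − δ/16)(N − 1)²/φ(q)` for `N` large (GS21 (V_q=));
* `nonUnitGen_sq_le_inst` — `Z₀² ≤ (δ/16)(N − 1)²/φ(q)` for `N` large (GS21 (Sq3));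
* `even_case_absurd`, `odd_case_absurd` — the two evaluations of `𝒮` are incompatible (GS21
  (key): `χ(−1)Γ(β₁)²N^{2(β₁−1)} ∈ [−(1 − δ) + o(1), (1 − δ) + o(1)]`).

## References

* D. A. Goldston, A. I. Suriajaya, *Note on the Goldbach conjecture and Landau–Siegel zeros*,
  arXiv:2104.09407 (2021), §3 (V_q=), (Sq1c); §4 (Sq3), (Sq4); §5 (key) and the proof of
  Theorem 3. [cite: GoldstonSuriajaya2021, §5]
-/

noncomputable section

open Finset Real
open scoped ArithmeticFunction.vonMangoldt

namespace Literature.Barriers.Parity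

namespace GoldstonSuriajaya

open Literature.NumberTheory.Sieve

/-! ### The weight `ρ = 1 − 1/N` -/

section weight

variable {N : ℕ}

/-- `0 < 1 − 1/N` for `N ≥ 2`. [folklore] -/
theorem rho_pos (hN : 2 ≤ N) : 0 < 1 - 1 / (N : ℝ) := by
  have hN' : (2 : ℝ) ≤ N := by exact_mod_cast hN
  have : 1 / (N : ℝ) ≤ 1 / 2 := by
    rw [div_le_div_iff₀ (by linarith) (by norm_num)]
    linarith
  linarith

/-- `1 − 1/N < 1` for `N ≥ 1`. [folklore] -/
theorem rho_lt_one (hN : 1 ≤ N) : 1 - 1 / (N : ℝ) < 1 := by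
  have hN' : (0 : ℝ) < N := by exact_mod_cast hN
  have : 0 < 1 / (N : ℝ) := by positivity
  linarith

/-- `1 − ρ = 1/N`. [folklore] -/
theorem one_sub_rho (N : ℕ) : 1 - (1 - 1 / (N : ℝ)) = 1 / (N : ℝ) := by ring

/-- `ρ/(1 − ρ) = N − 1`. [folklore] -/
theorem rho_div_one_sub_rho (hN : 1 ≤ N) : (1 - 1 / (N : ℝ)) / (1 - (1 - 1 / (N : ℝ))) = (N : ℝ) - 1 := by
  have hN' : (N : ℝ) ≠ 0 := by
    have : (1 : ℝ) ≤ N := by exact_mod_cast hN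
    linarith
  field_simp
  ring

/-- `M = (N − 1)/Φ` at `ρ = 1 − 1/N`. [folklore] -/
theorem mainM_rho (hN : 1 ≤ N) (Φ : ℝ) : mainM (1 - 1 / (N : ℝ)) Φ = ((N : ℝ) - 1) / Φ := by
  unfold mainM
  rw [← div_div, rho_div_one_sub_rho hN]

/-- Bernoulli: `1 − k/N ≤ ρ^k`. [folklore] -/
theorem one_sub_div_le_pow_rho (hN : 1 ≤ N) (k : ℕ) : 1 - (k : ℝ) / N ≤ (1 - 1 / (N : ℝ)) ^ k := by
  have hN' : (1 : ℝ) ≤ N := by exact_mod_cast hN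
  have h1 : (-2 : ℝ) ≤ -(1 / (N : ℝ)) := by
    have : 1 / (N : ℝ) ≤ 1 := (div_le_one (by linarith)).mpr hN'
    linarith
  have h := one_add_mul_le_pow h1 k
  have heq : (1 : ℝ) + k * -(1 / (N : ℝ)) = 1 - (k : ℝ) / N := by ring
  rw [heq, ← sub_eq_add_neg] at h
  exact h

/-- `ρ^k (1 + k/N) ≤ 1` (so `1 − ρ^k ≥ k/(N + k)`). [folklore] -/
theorem pow_rho_mul_le_one (hN : 1 ≤ N) (k : ℕ) : (1 - 1 / (N : ℝ)) ^ k * (1 + (k : ℝ) / N) ≤ 1 := by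
  have hN' : (1 : ℝ) ≤ N := by exact_mod_cast hN
  have hs0 : 0 ≤ 1 / (N : ℝ) := by positivity
  have hs1 : 1 / (N : ℝ) ≤ 1 := (div_le_one (by linarith)).mpr hN'
  have hρ0 : 0 ≤ 1 - 1 / (N : ℝ) := by linarith
  have hB : 1 + (k : ℝ) / N ≤ (1 + 1 / (N : ℝ)) ^ k := by
    have h := one_add_mul_le_pow (by linarith : (-2 : ℝ) ≤ 1 / (N : ℝ)) k
    have heq : (1 : ℝ) + k * (1 / (N : ℝ)) = 1 + (k : ℝ) / N := by ring
    rwa [heq] at h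
  calc (1 - 1 / (N : ℝ)) ^ k * (1 + (k : ℝ) / N) ≤ (1 - 1 / (N : ℝ)) ^ k * (1 + 1 / (N : ℝ)) ^ k :=
        mul_le_mul_of_nonneg_left hB (pow_nonneg hρ0 k)
    _ = (1 - (1 / (N : ℝ)) ^ 2) ^ k := by rw [← mul_pow]; ring
    _ ≤ 1 := pow_le_one₀ (by nlinarith) (by nlinarith)

/-- `k/(N + k) ≤ 1 − ρ^k`. [folklore] -/
theorem div_le_one_sub_pow_rho (hN : 1 ≤ N) (k : ℕ) :
    (k : ℝ) / ((N : ℝ) + k) ≤ 1 - (1 - 1 / (N : ℝ)) ^ k := by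
  have hN' : (1 : ℝ) ≤ N := by exact_mod_cast hN
  have hk : (0 : ℝ) ≤ k := Nat.cast_nonneg k
  have h := pow_rho_mul_le_one hN k
  have hx0 : 0 ≤ (1 - 1 / (N : ℝ)) ^ k := pow_nonneg (by
    have : 1 / (N : ℝ) ≤ 1 := (div_le_one (by linarith)).mpr hN'
    linarith) k
  rw [div_le_iff₀ (by linarith)]
  have h2 : (1 - 1 / (N : ℝ)) ^ k * ((N : ℝ) + k) ≤ N := by
    have : (1 - 1 / (N : ℝ)) ^ k * (1 + (k : ℝ) / N) * N ≤ 1 * N :=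
      mul_le_mul_of_nonneg_right h (by linarith)
    have heq : (1 - 1 / (N : ℝ)) ^ k * (1 + (k : ℝ) / N) * N = (1 - 1 / (N : ℝ)) ^ k * ((N : ℝ) + k) := by
      field_simp
    linarith
  nlinarith

/-- `ρ^{NL} ≤ e^{−L}`. [folklore] -/
theorem pow_rho_mul_le_exp_neg (hN : 1 ≤ N) (L : ℕ) :
    (1 - 1 / (N : ℝ)) ^ (N * L) ≤ Real.exp (-(L : ℝ)) := by
  have hN' : (1 : ℝ) ≤ N := by exact_mod_cast hN
  have hρ0 : 0 ≤ 1 - 1 / (N : ℝ) := by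
    have : 1 / (N : ℝ) ≤ 1 := (div_le_one (by linarith)).mpr hN'
    linarith
  have h1 : (1 - 1 / (N : ℝ)) ^ N ≤ Real.exp (-1) := Real.one_sub_div_pow_le_exp_neg hN'
  rw [pow_mul]
  calc ((1 - 1 / (N : ℝ)) ^ N) ^ L ≤ (Real.exp (-1)) ^ L := pow_le_pow_left₀ (pow_nonneg hρ0 N) h1 L
    _ = Real.exp (-(L : ℝ)) := by rw [← Real.exp_nat_mul]; ring_nf

end weight

/-! ### The exceptional term at `ρ = 1 − 1/N` -/

/-- A convenient `L`: `e^{−L}(1 + 2L) ≤ 6/L` for `L ≥ 1` (from `e^L ≥ L²/2`). [folklore] -/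
theorem exp_neg_mul_le_div {L : ℝ} (hL : 1 ≤ L) : Real.exp (-L) * (1 + 2 * L) ≤ 6 / L := by
  have hq := Real.quadratic_le_exp_of_nonneg (by linarith : (0 : ℝ) ≤ L)
  have hpos : 0 < Real.exp L := Real.exp_pos L
  rw [Real.exp_neg, le_div_iff₀ (by linarith)]
  rw [inv_mul_eq_div, div_mul_eq_mul_div, div_le_iff₀ hpos]
  nlinarith

/-- **The exceptional term is nearly the main term** (GS21 §5: `Γ(β₁)N^{β₁−1} = 1 + o(1)` unless
the repulsion holds). At `ρ = 1 − 1/N` (`N ≥ 2`), if `e^{−L}(1 + 2L) ≤ δ/64` and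
`(1 − β) log(NL) ≤ δ/64` then `S ≥ (1 − δ/32) M`, `M = (N − 1)/Φ`.
[cite: GoldstonSuriajaya2021, §5 (proof of Theorem 3)] -/
theorem excS_ge_inst {N L : ℕ} (hN : 2 ≤ N) (hL : 1 ≤ L) {β Φ δ : ℝ} (hβ0 : 0 < β) (hβ1 : β ≤ 1)
    (hΦ : 0 < Φ) (hδ1 : δ ≤ 1)
    (hexpL : Real.exp (-(L : ℝ)) * (1 + 2 * L) ≤ δ / 64)
    (hβU : (1 - β) * Real.log ((N * L : ℕ) : ℝ) ≤ δ / 64) :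
    (1 - δ / 32) * (((N : ℝ) - 1) / Φ) ≤ excS (1 - 1 / (N : ℝ)) β Φ := by
  have hN1 : 1 ≤ N := le_trans (by norm_num) hN
  have hN' : (2 : ℝ) ≤ N := by exact_mod_cast hN
  have hL' : (1 : ℝ) ≤ L := by exact_mod_cast hL
  have hρ0 := rho_pos hN
  have hρ1 := rho_lt_one hN1
  have hU : 1 ≤ N * L := Nat.one_le_iff_ne_zero.mpr (Nat.mul_ne_zero (by omega) (by omega))
  have hU0 : (0 : ℝ) < ((N * L : ℕ) : ℝ) := by exact_mod_cast hU
  have h := excS_ge hρ0 hρ1 hβ0 hβ1 hΦ hU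
  rw [mainM_rho hN1] at h
  set M : ℝ := ((N : ℝ) - 1) / Φ with hMdef
  have hM0 : 0 ≤ M := by rw [hMdef]; exact div_nonneg (by linarith) hΦ.le
  -- `ρ^U ≤ e^{-L}`
  have hρU : (1 - 1 / (N : ℝ)) ^ (N * L) ≤ Real.exp (-(L : ℝ)) := pow_rho_mul_le_exp_neg hN1 L
  have hρU0 : 0 ≤ (1 - 1 / (N : ℝ)) ^ (N * L) := pow_nonneg hρ0.le _
  have he1 : Real.exp (-(L : ℝ)) * (1 + 2 * L) ≤ δ / 64 := hexpL
  have he0 : 0 ≤ Real.exp (-(L : ℝ)) := (Real.exp_pos _).le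
  -- the bracket `M(1 − ρ^U) − ρ^U U/Φ ≥ M(1 − δ/64)`
  have hUΦ : ((N * L : ℕ) : ℝ) / Φ ≤ 2 * L * M := by
    rw [hMdef]
    push_cast
    rw [show 2 * (L : ℝ) * (((N : ℝ) - 1) / Φ) = (2 * L * ((N : ℝ) - 1)) / Φ by ring]
    exact div_le_div_of_nonneg_right (by nlinarith) hΦ.le
  have hbr : (1 - δ / 64) * M ≤
      M * (1 - (1 - 1 / (N : ℝ)) ^ (N * L)) - (1 - 1 / (N : ℝ)) ^ (N * L) * ((N * L : ℕ) : ℝ) / Φ := by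
    have h1 : (1 - 1 / (N : ℝ)) ^ (N * L) * ((N * L : ℕ) : ℝ) / Φ ≤ Real.exp (-(L : ℝ)) * (2 * L * M) := by
      rw [mul_div_assoc]
      exact mul_le_mul hρU hUΦ (by positivity) he0
    have h2 : M * (1 - Real.exp (-(L : ℝ))) ≤ M * (1 - (1 - 1 / (N : ℝ)) ^ (N * L)) :=
      mul_le_mul_of_nonneg_left (by linarith) hM0
    nlinarith
  -- `U^{β-1}/β ≥ 1 − δ/64`
  have hUβ : 1 - δ / 64 ≤ ((N * L : ℕ) : ℝ) ^ (β - 1) / β := by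
    have h1 : 1 - δ / 64 ≤ ((N * L : ℕ) : ℝ) ^ (β - 1) := by
      rw [Real.rpow_def_of_pos hU0]
      have := Real.add_one_le_exp (Real.log ((N * L : ℕ) : ℝ) * (β - 1))
      nlinarith
    have h2 : ((N * L : ℕ) : ℝ) ^ (β - 1) ≤ ((N * L : ℕ) : ℝ) ^ (β - 1) / β := by
      rw [le_div_iff₀ hβ0]
      have : 0 ≤ ((N * L : ℕ) : ℝ) ^ (β - 1) := by positivity
      nlinarith
    exact h1.trans h2
  have hd0 : 0 ≤ 1 - δ / 64 := by linarith
  calc (1 - δ / 32) * M ≤ (1 - δ / 64) * ((1 - δ / 64) * M) := by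
        nlinarith [mul_nonneg (sq_nonneg δ) hM0]
    _ ≤ ((N * L : ℕ) : ℝ) ^ (β - 1) / β *
        (M * (1 - (1 - 1 / (N : ℝ)) ^ (N * L)) - (1 - 1 / (N : ℝ)) ^ (N * L) * ((N * L : ℕ) : ℝ) / Φ) :=
        mul_le_mul hUβ hbr (mul_nonneg hd0 hM0) (hd0.trans hUβ)
    _ ≤ excS (1 - 1 / (N : ℝ)) β Φ := h

/-! ### The error term from (PNTAP) -/

/-- `ψ(0; q, b) = 0`. [folklore] -/
theorem chebyshevPsiMod_natCast_zero (q : ℕ) (b : ZMod q) : ParityWave0.chebyshevPsiMod q b (0 : ℕ) = 0 := by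
  rw [ParityWave0.chebyshevPsiMod, Nat.cast_zero, Nat.floor_zero]
  simp

/-- `ψ(1; q, b) = 0` (`Λ(0) = Λ(1) = 0`). [folklore] -/
theorem chebyshevPsiMod_natCast_one (q : ℕ) (b : ZMod q) : ParityWave0.chebyshevPsiMod q b (1 : ℕ) = 0 := by
  rw [ParityWave0.chebyshevPsiMod, Nat.cast_one, Nat.floor_one]
  rw [sum_range_succ, sum_range_one, ArithmeticFunction.vonMangoldt.residueClass_apply_zero, zero_add]
  have h1 := ArithmeticFunction.vonMangoldt.residueClass_le b 1
  rw [ArithmeticFunction.vonMangoldt_apply_one] at h1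
  exact le_antisymm h1 (ArithmeticFunction.vonMangoldt.residueClass_nonneg b 1)

/-- From (PNTAP) for `n ≥ 2` to the hypothesis of `psiGen_sub_main_le` for all `n`: the cases
`n = 0, 1` contribute at most `1/Φ + 1/(Φβ) ≤ 3` (`Φ ≥ 1`, `β > 2/3`, `|ε| ≤ 1`).
[cite: GoldstonSuriajaya2021, §4 (PNTAP)] -/
theorem approx_all {q : ℕ} (b : ZMod q) {β Φ ε K : ℝ} {w : ℕ → ℝ} (hw0 : ∀ n, 0 ≤ w n)
    (hΦ1 : 1 ≤ Φ) (hβ : 2 / 3 < β) (hβ0' : β ≠ 0) (hε : |ε| ≤ 1) (hK : 0 ≤ K)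
    (h2 : ∀ n : ℕ, 2 ≤ n →
      |ParityWave0.chebyshevPsiMod q b n - n / Φ + ε * (n : ℝ) ^ β / (Φ * β)| ≤ K * n * w n) :
    ∀ n : ℕ, |ParityWave0.chebyshevPsiMod q b n - n / Φ + ε * (n : ℝ) ^ β / (Φ * β)| ≤ 3 + K * n * w n := by
  intro n
  have hKw : 0 ≤ K * n * w n := by have := hw0 n; positivity
  rcases Nat.lt_or_ge n 2 with hn | hn
  · interval_cases n
    · rw [chebyshevPsiMod_natCast_zero, Nat.cast_zero, Real.zero_rpow hβ0', zero_div, mul_zero,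
        zero_div]
      norm_num
    · rw [chebyshevPsiMod_natCast_one, Nat.cast_one, Real.one_rpow]
      rw [Nat.cast_one] at hKw
      have hΦ0 : 0 < Φ := by linarith
      have hβ0 : 0 < β := by linarith
      have hΦβ : 0 < Φ * β := by positivity
      have h1 : |(0 : ℝ) - 1 / Φ + ε * 1 / (Φ * β)| ≤ 1 / Φ + 1 / (Φ * β) := by
        refine (abs_add_le _ _).trans (add_le_add ?_ ?_)
        · rw [zero_sub, abs_neg, abs_of_pos (show 0 < 1 / Φ by positivity)]
        · rw [mul_one, abs_div, abs_of_pos hΦβ]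
          exact div_le_div_of_nonneg_right hε hΦβ.le
      have h2 : 1 / Φ ≤ 1 := (div_le_one hΦ0).mpr hΦ1
      have h3 : 1 / (Φ * β) ≤ 3 / 2 := by
        rw [div_le_div_iff₀ hΦβ (by norm_num)]
        nlinarith
      linarith
  · exact (h2 n hn).trans (by linarith)

/-- **The error is `o(M)`** for `N` large: at `ρ = 1 − 1/N`,
`3 + KY²(1 − ρ) + K q^{−2} ρ/(1 − ρ) ≤ (δ/100)(N − 1)/Φ` once `Φ ≤ 2q`, `1800q ≤ δ(N − 1)`,
`600qKY² ≤ δN(N − 1)` and `600K ≤ δq` (GS21 §5: `φ(q)e^{−c₁√log N} = o(1)` for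
`log N = (log q/c'')²`). [cite: GoldstonSuriajaya2021, §5 (proof of Theorem 3)] -/
theorem errE_le {N Y q : ℕ} (hN : 2 ≤ N) (hq : 1 ≤ q) {K Φ δ : ℝ} (hΦ : 0 < Φ)
    (hΦq : Φ ≤ 2 * q) (h1 : 1800 * (q : ℝ) ≤ δ * ((N : ℝ) - 1))
    (h2 : 600 * (q : ℝ) * K * (Y : ℝ) ^ 2 ≤ δ * N * ((N : ℝ) - 1)) (h3 : 600 * K ≤ δ * q) :
    3 + K * (Y : ℝ) ^ 2 * (1 - (1 - 1 / (N : ℝ))) + K * (1 / (q : ℝ) ^ 2) *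
        ((1 - 1 / (N : ℝ)) / (1 - (1 - 1 / (N : ℝ)))) ≤ δ / 100 * (((N : ℝ) - 1) / Φ) := by
  have hN1 : 1 ≤ N := le_trans (by norm_num) hN
  have hN' : (2 : ℝ) ≤ N := by exact_mod_cast hN
  have hq' : (1 : ℝ) ≤ q := by exact_mod_cast hq
  rw [rho_div_one_sub_rho hN1, one_sub_rho]
  -- compare with `(δ/200)(N-1)/q ≤ (δ/100)(N-1)/Φ`
  have hcmp : δ / 200 * (((N : ℝ) - 1) / q) ≤ δ / 100 * (((N : ℝ) - 1) / Φ) := by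
    rw [show δ / 200 * (((N : ℝ) - 1) / q) = δ * ((N : ℝ) - 1) / (200 * q) by ring,
      show δ / 100 * (((N : ℝ) - 1) / Φ) = δ * ((N : ℝ) - 1) / (100 * Φ) by ring]
    exact div_le_div_of_nonneg_left (by nlinarith) (by positivity) (by linarith)
  refine le_trans ?_ hcmp
  have hA : (3 : ℝ) ≤ δ / 600 * (((N : ℝ) - 1) / q) := by
    rw [show δ / 600 * (((N : ℝ) - 1) / q) = δ * ((N : ℝ) - 1) / (600 * q) by ring,
      le_div_iff₀ (by positivity)]
    linarith
  have hB : K * (Y : ℝ) ^ 2 * (1 / (N : ℝ)) ≤ δ / 600 * (((N : ℝ) - 1) / q) := by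
    rw [show δ / 600 * (((N : ℝ) - 1) / q) = δ * ((N : ℝ) - 1) / (600 * q) by ring,
      show K * (Y : ℝ) ^ 2 * (1 / (N : ℝ)) = K * (Y : ℝ) ^ 2 / N by ring,
      div_le_div_iff₀ (by positivity) (by positivity)]
    nlinarith
  have hC : K * (1 / (q : ℝ) ^ 2) * ((N : ℝ) - 1) ≤ δ / 600 * (((N : ℝ) - 1) / q) := by
    rw [show δ / 600 * (((N : ℝ) - 1) / q) = δ * ((N : ℝ) - 1) / (600 * q) by ring,
      show K * (1 / (q : ℝ) ^ 2) * ((N : ℝ) - 1) = K * ((N : ℝ) - 1) / (q : ℝ) ^ 2 by ring,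
      div_le_div_iff₀ (by positivity) (by positivity)]
    have hN0 : (0 : ℝ) ≤ (N : ℝ) - 1 := by linarith
    nlinarith [mul_le_mul_of_nonneg_right h3 (mul_nonneg hN0 (by positivity : (0 : ℝ) ≤ q))]
  linarith

/-! ### The singular-series side at `x = ρ^q` -/

/-- Numerics for the upper form: `(1 + δ/64)(N + q)² + (3/2 + K₀)q(N + q) ≤ (1 + δ/16)(N − 1)²`
once `256(q + 1) ≤ δ(N − 1)` and `128(3/2 + K₀)q ≤ δ(N − 1)`. [folklore] -/
theorem le_numerics {q N K₀ : ℕ} {δ : ℝ} (hδ : 0 < δ) (hδ1 : δ ≤ 1)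
    (h1 : 256 * ((q : ℝ) + 1) ≤ δ * ((N : ℝ) - 1))
    (h2 : 128 * (3 / 2 + (K₀ : ℝ)) * q ≤ δ * ((N : ℝ) - 1)) :
    (1 + δ / 64) * ((N : ℝ) + q) ^ 2 + (3 / 2 + K₀) * q * ((N : ℝ) + q) ≤
      (1 + δ / 16) * ((N : ℝ) - 1) ^ 2 := by
  have hq0 : (0 : ℝ) ≤ q := Nat.cast_nonneg q
  have hN1 : (0 : ℝ) ≤ (N : ℝ) - 1 := by nlinarith
  have hNq : (N : ℝ) + q ≤ (1 + δ / 256) * ((N : ℝ) - 1) := by linarith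
  have hδN : δ * ((N : ℝ) - 1) ≤ (N : ℝ) - 1 := mul_le_of_le_one_left hN1 hδ1
  have hNq' : (N : ℝ) + q ≤ 2 * ((N : ℝ) - 1) := by linarith
  have hsq : ((N : ℝ) + q) ^ 2 ≤ (1 + δ / 256) ^ 2 * ((N : ℝ) - 1) ^ 2 := by
    rw [← mul_pow]
    exact pow_le_pow_left₀ (by positivity) hNq 2
  have hlin : (3 / 2 + (K₀ : ℝ)) * q * ((N : ℝ) + q) ≤ δ / 64 * ((N : ℝ) - 1) ^ 2 := by
    have hK0 : (0 : ℝ) ≤ (3 / 2 + K₀) * q := by positivity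
    calc (3 / 2 + (K₀ : ℝ)) * q * ((N : ℝ) + q) ≤ (3 / 2 + (K₀ : ℝ)) * q * (2 * ((N : ℝ) - 1)) :=
          mul_le_mul_of_nonneg_left hNq' hK0
      _ = (128 * (3 / 2 + (K₀ : ℝ)) * q) * ((N : ℝ) - 1) / 64 := by ring
      _ ≤ (δ * ((N : ℝ) - 1)) * ((N : ℝ) - 1) / 64 :=
          div_le_div_of_nonneg_right (mul_le_mul_of_nonneg_right h2 hN1) (by norm_num)
      _ = δ / 64 * ((N : ℝ) - 1) ^ 2 := by ring
  have hP0 : 0 ≤ ((N : ℝ) - 1) ^ 2 := sq_nonneg _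
  have hd2 : δ ^ 2 ≤ 1 := by nlinarith
  have hcoef : (1 + δ / 64) * (1 + δ / 256) ^ 2 + δ / 64 ≤ 1 + δ / 16 := by
    have hinner : (0 : ℝ) ≤ 3 / 128 - 9 * δ / 65536 - δ ^ 2 / 4194304 := by linarith
    nlinarith [mul_nonneg hδ.le hinner]
  have hA : (1 + δ / 64) * ((N : ℝ) + q) ^ 2 ≤ (1 + δ / 64) * ((1 + δ / 256) ^ 2 * ((N : ℝ) - 1) ^ 2) :=
    mul_le_mul_of_nonneg_left hsq (by positivity)
  calc (1 + δ / 64) * ((N : ℝ) + q) ^ 2 + (3 / 2 + K₀) * q * ((N : ℝ) + q)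
      ≤ (1 + δ / 64) * ((1 + δ / 256) ^ 2 * ((N : ℝ) - 1) ^ 2) + δ / 64 * ((N : ℝ) - 1) ^ 2 :=
        add_le_add hA hlin
    _ = ((1 + δ / 64) * (1 + δ / 256) ^ 2 + δ / 64) * ((N : ℝ) - 1) ^ 2 := by ring
    _ ≤ (1 + δ / 16) * ((N : ℝ) - 1) ^ 2 := mul_le_mul_of_nonneg_right hcoef hP0

/-- Numerics for the lower form: `(1 − δ/16)(N − 1)² ≤ (1 − δ/32)(N − q)² − q²K₀²/2` once
`q ≤ N`, `128(q − 1) ≤ δ(N − 1)` and `32qK₀ ≤ δ(N − 1)`. [folklore] -/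
theorem ge_numerics {q N K₀ : ℕ} (hqN : q ≤ N) {δ : ℝ} (hδ : 0 < δ) (hδ1 : δ ≤ 1)
    (h1 : 128 * ((q : ℝ) - 1) ≤ δ * ((N : ℝ) - 1)) (h2 : 32 * (q : ℝ) * K₀ ≤ δ * ((N : ℝ) - 1))
    (hN1 : (0 : ℝ) ≤ (N : ℝ) - 1) :
    (1 - δ / 16) * ((N : ℝ) - 1) ^ 2 ≤
      (1 - 2 * (δ / 64)) * ((N : ℝ) - q) ^ 2 - (q : ℝ) ^ 2 * (K₀ : ℝ) ^ 2 / 2 := by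
  have hqN' : (q : ℝ) ≤ N := by exact_mod_cast hqN
  have hNq : (1 - δ / 128) * ((N : ℝ) - 1) ≤ (N : ℝ) - q := by linarith
  have hNq0 : 0 ≤ (1 - δ / 128) * ((N : ℝ) - 1) := mul_nonneg (by linarith) hN1
  have hsq2 : (1 - δ / 128) ^ 2 * ((N : ℝ) - 1) ^ 2 ≤ ((N : ℝ) - q) ^ 2 := by
    rw [← mul_pow]
    exact pow_le_pow_left₀ hNq0 hNq 2
  have hP0 : 0 ≤ ((N : ℝ) - 1) ^ 2 := sq_nonneg _
  have hd2 : δ ^ 2 ≤ δ := by nlinarith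
  have hK : (q : ℝ) ^ 2 * (K₀ : ℝ) ^ 2 / 2 ≤ δ / 64 * ((N : ℝ) - 1) ^ 2 := by
    have h3 : (q : ℝ) * K₀ ≤ δ / 32 * ((N : ℝ) - 1) := by linarith
    have h30 : 0 ≤ (q : ℝ) * K₀ := by positivity
    have h4 : ((q : ℝ) * K₀) ^ 2 ≤ (δ / 32 * ((N : ℝ) - 1)) ^ 2 := pow_le_pow_left₀ h30 h3 2
    have h5 := mul_le_mul_of_nonneg_right hd2 hP0
    have h6 : 0 ≤ δ * ((N : ℝ) - 1) ^ 2 := by positivity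
    calc (q : ℝ) ^ 2 * (K₀ : ℝ) ^ 2 / 2 = ((q : ℝ) * K₀) ^ 2 / 2 := by ring
      _ ≤ (δ / 32 * ((N : ℝ) - 1)) ^ 2 / 2 := by linarith
      _ = δ ^ 2 * ((N : ℝ) - 1) ^ 2 / 2048 := by ring
      _ ≤ δ / 64 * ((N : ℝ) - 1) ^ 2 := by linarith
  have hcoef : 1 - δ / 16 + δ / 64 ≤ (1 - 2 * (δ / 64)) * (1 - δ / 128) ^ 2 := by
    have hinner : (0 : ℝ) ≤ 9 / 16384 - δ / 524288 := by linarith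
    nlinarith [mul_nonneg (sq_nonneg δ) hinner]
  have hη : (0 : ℝ) ≤ 1 - 2 * (δ / 64) := by linarith
  have hA : (1 - 2 * (δ / 64)) * ((1 - δ / 128) ^ 2 * ((N : ℝ) - 1) ^ 2) ≤
      (1 - 2 * (δ / 64)) * ((N : ℝ) - q) ^ 2 := mul_le_mul_of_nonneg_left hsq2 hη
  have hB := mul_le_mul_of_nonneg_right hcoef hP0
  calc (1 - δ / 16) * ((N : ℝ) - 1) ^ 2
      = (1 - δ / 16 + δ / 64) * ((N : ℝ) - 1) ^ 2 - δ / 64 * ((N : ℝ) - 1) ^ 2 := by ring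
    _ ≤ (1 - 2 * (δ / 64)) * ((1 - δ / 128) ^ 2 * ((N : ℝ) - 1) ^ 2) - δ / 64 * ((N : ℝ) - 1) ^ 2 := by
        linarith
    _ ≤ (1 - 2 * (δ / 64)) * ((N : ℝ) - q) ^ 2 - (q : ℝ) ^ 2 * (K₀ : ℝ) ^ 2 / 2 := by linarith

/-- **GS21 (V_q=), upper form at `x = (1 − 1/N)^q`**: `qW ≤ (1 + δ/16)(N − 1)²/φ(q)` once
`256(q + 1) ≤ δ(N − 1)` and `128(3/2 + K₀)q ≤ δ(N − 1)` (`η = δ/64`).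
[cite: GoldstonSuriajaya2021, §3 (V_q=)] -/
theorem mul_singW_le_inst {q N K₀ : ℕ} (hq : q ≠ 0) (hN : 2 ≤ N) {δ : ℝ} (hδ : 0 < δ) (hδ1 : δ ≤ 1)
    (hlow : ∀ K : ℕ, K₀ ≤ K →
      (1 - δ / 64) * ((q : ℝ) / Nat.totient q) * ((K : ℝ) - 1) ≤ singG q K)
    (h1 : 256 * ((q : ℝ) + 1) ≤ δ * ((N : ℝ) - 1))
    (h2 : 128 * (3 / 2 + (K₀ : ℝ)) * q ≤ δ * ((N : ℝ) - 1)) :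
    (q : ℝ) * singW q ((1 - 1 / (N : ℝ)) ^ q) ≤ (1 + δ / 16) * (((N : ℝ) - 1) ^ 2 / Nat.totient q) := by
  have hN1 : 1 ≤ N := le_trans (by norm_num) hN
  have hN' : (2 : ℝ) ≤ N := by exact_mod_cast hN
  have hq' : (1 : ℝ) ≤ q := by exact_mod_cast Nat.one_le_iff_ne_zero.mpr hq
  have hρ0 := rho_pos hN
  have hρ1 := rho_lt_one hN1
  have hx0 : 0 ≤ (1 - 1 / (N : ℝ)) ^ q := pow_nonneg hρ0.le q
  have hx1 : (1 - 1 / (N : ℝ)) ^ q < 1 := pow_lt_one₀ hρ0.le hρ1 hq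
  have hφ : (0 : ℝ) < Nat.totient q := by exact_mod_cast Nat.totient_pos.mpr (Nat.pos_of_ne_zero hq)
  have hnum := le_numerics (q := q) (N := N) (K₀ := K₀) hδ hδ1 h1 h2
  -- `1/(1 − x) ≤ (N + q)/q`
  have h1x : 0 < 1 - (1 - 1 / (N : ℝ)) ^ q := by linarith
  have hinv : 1 / (1 - (1 - 1 / (N : ℝ)) ^ q) ≤ ((N : ℝ) + q) / q := by
    have h := div_le_one_sub_pow_rho hN1 q
    rw [div_le_div_iff₀ h1x (by positivity), one_mul]
    rw [div_le_iff₀ (by positivity)] at h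
    linarith
  have hinv0 : 0 ≤ 1 / (1 - (1 - 1 / (N : ℝ)) ^ q) := by positivity
  have hinv2 : 1 / (1 - (1 - 1 / (N : ℝ)) ^ q) ^ 2 ≤ (((N : ℝ) + q) / q) ^ 2 := by
    rw [← one_div_pow]
    exact pow_le_pow_left₀ hinv0 hinv 2
  have hK0 : (0 : ℝ) ≤ 3 / 2 + K₀ := by positivity
  -- the abstract bound
  have hW := singW_le hq hx0 hx1 (by positivity : 0 < δ / 64) (by linarith) hlow
  calc (q : ℝ) * singW q ((1 - 1 / (N : ℝ)) ^ q)
      ≤ q * ((q : ℝ) / Nat.totient q * ((1 + δ / 64) / (1 - (1 - 1 / (N : ℝ)) ^ q) ^ 2 +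
          (3 / 2 + K₀) / (1 - (1 - 1 / (N : ℝ)) ^ q))) := mul_le_mul_of_nonneg_left hW (by positivity)
    _ = q * ((q : ℝ) / Nat.totient q) * ((1 + δ / 64) * (1 / (1 - (1 - 1 / (N : ℝ)) ^ q) ^ 2) +
          (3 / 2 + K₀) * (1 / (1 - (1 - 1 / (N : ℝ)) ^ q))) := by ring
    _ ≤ q * ((q : ℝ) / Nat.totient q) * ((1 + δ / 64) * (((N : ℝ) + q) / q) ^ 2 +
          (3 / 2 + K₀) * (((N : ℝ) + q) / q)) := by
        refine mul_le_mul_of_nonneg_left (add_le_add ?_ ?_) (by positivity)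
        · exact mul_le_mul_of_nonneg_left hinv2 (by positivity)
        · exact mul_le_mul_of_nonneg_left hinv hK0
    _ = (1 / Nat.totient q) * ((1 + δ / 64) * ((N : ℝ) + q) ^ 2 + (3 / 2 + K₀) * q * ((N : ℝ) + q)) := by
        field_simp
    _ ≤ (1 / Nat.totient q) * ((1 + δ / 16) * ((N : ℝ) - 1) ^ 2) :=
        mul_le_mul_of_nonneg_left hnum (by positivity)
    _ = (1 + δ / 16) * (((N : ℝ) - 1) ^ 2 / Nat.totient q) := by ring

/-- **GS21 (V_q=), lower form at `x = (1 − 1/N)^q`**: `qW ≥ (1 − δ/16)(N − 1)²/φ(q)` once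
`q ≤ N`, `128(q − 1) ≤ δ(N − 1)` and `32qK₀ ≤ δ(N − 1)` (`η = δ/64`).
[cite: GoldstonSuriajaya2021, §3 (V_q=)] -/
theorem mul_singW_ge_inst {q N K₀ : ℕ} (hq : q ≠ 0) (hN : 2 ≤ N) (hqN : q ≤ N) {δ : ℝ} (hδ : 0 < δ)
    (hδ1 : δ ≤ 1)
    (hlow : ∀ K : ℕ, K₀ ≤ K →
      (1 - δ / 64) * ((q : ℝ) / Nat.totient q) * ((K : ℝ) - 1) ≤ singG q K)
    (h1 : 128 * ((q : ℝ) - 1) ≤ δ * ((N : ℝ) - 1)) (h2 : 32 * (q : ℝ) * K₀ ≤ δ * ((N : ℝ) - 1)) :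
    (1 - δ / 16) * (((N : ℝ) - 1) ^ 2 / Nat.totient q) ≤ (q : ℝ) * singW q ((1 - 1 / (N : ℝ)) ^ q) := by
  have hN1 : 1 ≤ N := le_trans (by norm_num) hN
  have hN' : (2 : ℝ) ≤ N := by exact_mod_cast hN
  have hq1 : 1 ≤ q := Nat.one_le_iff_ne_zero.mpr hq
  have hq' : (1 : ℝ) ≤ q := by exact_mod_cast hq1
  have hqN' : (q : ℝ) ≤ N := by exact_mod_cast hqN
  have hρ0 := rho_pos hN
  have hρ1 := rho_lt_one hN1
  have hx0 : 0 ≤ (1 - 1 / (N : ℝ)) ^ q := pow_nonneg hρ0.le q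
  have hx1 : (1 - 1 / (N : ℝ)) ^ q < 1 := pow_lt_one₀ hρ0.le hρ1 hq
  have hφ : (0 : ℝ) < Nat.totient q := by exact_mod_cast Nat.totient_pos.mpr (Nat.pos_of_ne_zero hq)
  have hnum := ge_numerics (K₀ := K₀) hqN hδ hδ1 h1 h2 (by linarith)
  -- `x/(1 − x) ≥ (N − q)/q`
  have h1x : 0 < 1 - (1 - 1 / (N : ℝ)) ^ q := by linarith
  have hxlow : 1 - (q : ℝ) / N ≤ (1 - 1 / (N : ℝ)) ^ q := one_sub_div_le_pow_rho hN1 q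
  have hratio : ((N : ℝ) - q) / q ≤ (1 - 1 / (N : ℝ)) ^ q / (1 - (1 - 1 / (N : ℝ)) ^ q) := by
    rw [div_le_div_iff₀ (by positivity) h1x]
    have hle : 1 - (1 - 1 / (N : ℝ)) ^ q ≤ (q : ℝ) / N := by linarith
    have hNq0 : 0 ≤ (N : ℝ) - q := by linarith
    have h0N : (0 : ℝ) < N := by linarith
    calc ((N : ℝ) - q) * (1 - (1 - 1 / (N : ℝ)) ^ q) ≤ ((N : ℝ) - q) * ((q : ℝ) / N) :=
          mul_le_mul_of_nonneg_left hle hNq0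
      _ = (1 - (q : ℝ) / N) * q := by field_simp
      _ ≤ (1 - 1 / (N : ℝ)) ^ q * q := mul_le_mul_of_nonneg_right hxlow (by positivity)
  have hratio0 : 0 ≤ ((N : ℝ) - q) / q := div_nonneg (by linarith) (by positivity)
  have hsq : (((N : ℝ) - q) / q) ^ 2 ≤ ((1 - 1 / (N : ℝ)) ^ q) ^ 2 / (1 - (1 - 1 / (N : ℝ)) ^ q) ^ 2 := by
    rw [← div_pow]
    exact pow_le_pow_left₀ hratio0 hratio 2
  have hη : (0 : ℝ) ≤ 1 - 2 * (δ / 64) := by linarith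
  have hsqη := mul_le_mul_of_nonneg_left hsq hη
  -- the abstract bound
  have hW := singW_ge hq hx0 hx1 (by positivity : 0 < δ / 64) hlow
  calc (1 - δ / 16) * (((N : ℝ) - 1) ^ 2 / Nat.totient q)
      = (1 / Nat.totient q) * ((1 - δ / 16) * ((N : ℝ) - 1) ^ 2) := by ring
    _ ≤ (1 / Nat.totient q) * ((1 - 2 * (δ / 64)) * ((N : ℝ) - q) ^ 2 - (q : ℝ) ^ 2 * (K₀ : ℝ) ^ 2 / 2) :=
        mul_le_mul_of_nonneg_left hnum (by positivity)
    _ = q * ((q : ℝ) / Nat.totient q) * ((1 - 2 * (δ / 64)) * (((N : ℝ) - q) / q) ^ 2 - (K₀ : ℝ) ^ 2 / 2) := by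
        field_simp
    _ ≤ q * ((q : ℝ) / Nat.totient q) *
          ((1 - 2 * (δ / 64)) * (((1 - 1 / (N : ℝ)) ^ q) ^ 2 / (1 - (1 - 1 / (N : ℝ)) ^ q) ^ 2) -
            (K₀ : ℝ) ^ 2 / 2) :=
        mul_le_mul_of_nonneg_left (sub_le_sub_right hsqη _) (by positivity)
    _ = q * ((q : ℝ) / Nat.totient q *
          ((1 - 2 * (δ / 64)) * ((1 - 1 / (N : ℝ)) ^ q) ^ 2 / (1 - (1 - 1 / (N : ℝ)) ^ q) ^ 2 -
            (K₀ : ℝ) ^ 2 / 2)) := by ring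
    _ ≤ (q : ℝ) * singW q ((1 - 1 / (N : ℝ)) ^ q) := mul_le_mul_of_nonneg_left hW (by positivity)

/-! ### The classes `(b, q) > 1` at `ρ = 1 − 1/N` -/

/-- `ω(q) ≤ q`. [folklore] -/
theorem card_primeFactors_le (q : ℕ) : (q.primeFactors.card : ℝ) ≤ q := by
  have h : q.primeFactors ⊆ Icc 1 q := fun p hp =>
    mem_Icc.mpr ⟨(Nat.prime_of_mem_primeFactors hp).one_le, Nat.le_of_mem_primeFactors hp⟩
  have := card_le_card h
  rw [Nat.card_Icc, Nat.add_sub_cancel] at this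
  exact_mod_cast this

/-- **GS21 (Sq3) at `ρ = 1 − 1/N`**: `Z₀² ≤ (δ/16)(N − 1)²/φ(q)` once `64q³N ≤ δ(N − 1)²`
(`Z₀ ≤ 2ω(q)√N`, `ω(q) ≤ q`, `φ(q) ≤ q`). [cite: GoldstonSuriajaya2021, §4 (Sq3)] -/
theorem nonUnitGen_sq_le_inst {q N : ℕ} [NeZero q] (hN : 2 ≤ N) {δ : ℝ}
    (h : 64 * (q : ℝ) ^ 3 * N ≤ δ * ((N : ℝ) - 1) ^ 2) :
    nonUnitGen q (1 - 1 / (N : ℝ)) ^ 2 ≤ δ / 16 * (((N : ℝ) - 1) ^ 2 / Nat.totient q) := by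
  have hN1 : 1 ≤ N := le_trans (by norm_num) hN
  have hN' : (2 : ℝ) ≤ N := by exact_mod_cast hN
  have hq0 : q ≠ 0 := NeZero.ne q
  have hq' : (1 : ℝ) ≤ q := by exact_mod_cast Nat.one_le_iff_ne_zero.mpr hq0
  have hρ0 := rho_pos hN
  have hρ1 := rho_lt_one hN1
  have hφ : (0 : ℝ) < Nat.totient q := by exact_mod_cast Nat.totient_pos.mpr (Nat.pos_of_ne_zero hq0)
  have hφq : (Nat.totient q : ℝ) ≤ q := by exact_mod_cast Nat.totient_le q
  have hNpos : (0 : ℝ) < N := by linarith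
  have hZ := nonUnitGen_le q hρ0.le hρ1 hNpos
  have hsN : 0 < Real.sqrt N := Real.sqrt_pos.mpr hNpos
  have hsN2 : Real.sqrt N * Real.sqrt N = N := Real.mul_self_sqrt hNpos.le
  have hrew : (1 - 1 / (N : ℝ)) / ((1 - (1 - 1 / (N : ℝ))) * Real.sqrt N) = ((N : ℝ) - 1) / Real.sqrt N := by
    rw [one_sub_rho]
    field_simp
  rw [hrew] at hZ
  -- `(N-1)/√N + √N ≤ 2√N`
  have h2 : ((N : ℝ) - 1) / Real.sqrt N + Real.sqrt N ≤ 2 * Real.sqrt N := by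
    rw [div_add' _ _ _ hsN.ne', div_le_iff₀ hsN]
    nlinarith
  have hZ' : nonUnitGen q (1 - 1 / (N : ℝ)) ≤ q * (2 * Real.sqrt N) := by
    refine hZ.trans ?_
    exact mul_le_mul (card_primeFactors_le q) h2
      (add_nonneg (div_nonneg (by linarith) hsN.le) hsN.le) (by positivity)
  have hZ0 : 0 ≤ nonUnitGen q (1 - 1 / (N : ℝ)) := nonUnitGen_nonneg q hρ0.le
  calc nonUnitGen q (1 - 1 / (N : ℝ)) ^ 2 ≤ ((q : ℝ) * (2 * Real.sqrt N)) ^ 2 := pow_le_pow_left₀ hZ0 hZ' 2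
    _ = 4 * (q : ℝ) ^ 2 * N := by rw [mul_pow, mul_pow, sq (Real.sqrt N), hsN2]; ring
    _ ≤ δ / 16 * (((N : ℝ) - 1) ^ 2 / q) := by
        rw [show δ / 16 * (((N : ℝ) - 1) ^ 2 / q) = δ * ((N : ℝ) - 1) ^ 2 / (16 * q) by ring,
          le_div_iff₀ (by positivity)]
        nlinarith
    _ ≤ δ / 16 * (((N : ℝ) - 1) ^ 2 / Nat.totient q) := by
        have hδ0 : 0 ≤ δ := by
          have : (0 : ℝ) ≤ 64 * (q : ℝ) ^ 3 * N := by positivity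
          have hP : (0 : ℝ) < ((N : ℝ) - 1) ^ 2 := by nlinarith
          nlinarith
        refine mul_le_mul_of_nonneg_left ?_ (by positivity)
        exact div_le_div_of_nonneg_left (sq_nonneg _) hφ hφq

/-! ### The two evaluations are incompatible -/

/-- **GS21 (key), even parity**: the lower bound `Φ(M² + S² − 2(M + S)E − E²)` from (PNTAP)
and the upper bound `(2 − δ)qW` from (B) cannot both hold when `S ≥ (1 − δ/32)M`,
`S ≤ (3/2)M`, `E ≤ (δ/100)M` and `qW ≤ (1 + δ/16)ΦM²`. [cite: GoldstonSuriajaya2021, §5 (key)] -/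
theorem even_case_absurd {Φ M S E G Wq δ : ℝ} (hΦ : 0 < Φ) (hM : 0 < M) (hδ : 0 < δ) (hδ1 : δ < 1)
    (hLB : Φ * (M ^ 2 + S ^ 2 - 2 * (M + S) * E - E ^ 2) ≤ G) (hUB : G ≤ (2 - δ) * Wq)
    (hW : Wq ≤ (1 + δ / 16) * (Φ * M ^ 2)) (hS1 : (1 - δ / 32) * M ≤ S) (hS2 : S ≤ 3 / 2 * M)
    (hE0 : 0 ≤ E) (hE : E ≤ δ / 100 * M) : False := by
  have hS0 : 0 ≤ (1 - δ / 32) * M := by nlinarith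
  have h1 : (1 - δ / 16) * M ^ 2 ≤ S ^ 2 := by nlinarith [mul_le_mul hS1 hS1 hS0 (hS0.trans hS1)]
  have h2 : 2 * (M + S) * E + E ^ 2 ≤ δ / 16 * M ^ 2 := by
    have hMS : M + S ≤ 5 / 2 * M := by linarith
    have h3 : (M + S) * E ≤ 5 / 2 * M * (δ / 100 * M) :=
      mul_le_mul hMS hE hE0 (by positivity)
    have h4 : E ^ 2 ≤ (δ / 100 * M) ^ 2 := pow_le_pow_left₀ hE0 hE 2
    nlinarith
  have h5 : Φ * ((2 - δ / 8) * M ^ 2) ≤ Φ * (M ^ 2 + S ^ 2 - 2 * (M + S) * E - E ^ 2) :=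
    mul_le_mul_of_nonneg_left (by nlinarith) hΦ.le
  have h6 : (2 - δ) * Wq ≤ (2 - δ) * ((1 + δ / 16) * (Φ * M ^ 2)) :=
    mul_le_mul_of_nonneg_left hW (by linarith)
  have hP : 0 < Φ * M ^ 2 := by positivity
  have hchain : Φ * ((2 - δ / 8) * M ^ 2) ≤ (2 - δ) * ((1 + δ / 16) * (Φ * M ^ 2)) :=
    h5.trans (hLB.trans (hUB.trans h6))
  nlinarith [mul_pos hP hδ, mul_pos (mul_pos hP hδ) hδ]

/-- **GS21 (key), odd parity**: the lower bound `δqW` from (A) and the upper bound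
`Φ(M² − S² + 2(M + S)E + E²) + Z₀²` from (PNTAP) cannot both hold when `S ≥ (1 − δ/32)M`,
`S ≤ (3/2)M`, `E ≤ (δ/100)M`, `qW ≥ (1 − δ/16)ΦM²` and `Z₀² ≤ (δ/16)ΦM²`.
[cite: GoldstonSuriajaya2021, §5 (key)] -/
theorem odd_case_absurd {Φ M S E G Wq Z2 δ : ℝ} (hΦ : 0 < Φ) (hM : 0 < M) (hδ : 0 < δ) (hδ1 : δ < 1)
    (hLB : δ * Wq ≤ G) (hUB : G ≤ Φ * (M ^ 2 - S ^ 2 + 2 * (M + S) * E + E ^ 2) + Z2)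
    (hW : (1 - δ / 16) * (Φ * M ^ 2) ≤ Wq) (hZ : Z2 ≤ δ / 16 * (Φ * M ^ 2))
    (hS1 : (1 - δ / 32) * M ≤ S) (hS2 : S ≤ 3 / 2 * M) (hE0 : 0 ≤ E) (hE : E ≤ δ / 100 * M) :
    False := by
  have hS0 : 0 ≤ (1 - δ / 32) * M := by nlinarith
  have h1 : (1 - δ / 16) * M ^ 2 ≤ S ^ 2 := by nlinarith [mul_le_mul hS1 hS1 hS0 (hS0.trans hS1)]
  have h2 : 2 * (M + S) * E + E ^ 2 ≤ δ / 16 * M ^ 2 := by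
    have hMS : M + S ≤ 5 / 2 * M := by linarith
    have h3 : (M + S) * E ≤ 5 / 2 * M * (δ / 100 * M) :=
      mul_le_mul hMS hE hE0 (by positivity)
    have h4 : E ^ 2 ≤ (δ / 100 * M) ^ 2 := pow_le_pow_left₀ hE0 hE 2
    nlinarith
  have h5 : Φ * (M ^ 2 - S ^ 2 + 2 * (M + S) * E + E ^ 2) ≤ Φ * (δ / 8 * M ^ 2) :=
    mul_le_mul_of_nonneg_left (by nlinarith) hΦ.le
  have h6 : δ * ((1 - δ / 16) * (Φ * M ^ 2)) ≤ δ * Wq := mul_le_mul_of_nonneg_left hW hδ.le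
  have hP : 0 < Φ * M ^ 2 := by positivity
  have hchain : δ * ((1 - δ / 16) * (Φ * M ^ 2)) ≤ Φ * (δ / 8 * M ^ 2) + δ / 16 * (Φ * M ^ 2) :=
    h6.trans (hLB.trans (hUB.trans (add_le_add h5 hZ)))
  nlinarith [mul_pos hδ hP, mul_pos (mul_pos hP hδ) hδ]

end GoldstonSuriajaya

end Literature.Barriers.Parity
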